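import Summits.QuantumFields.YangMills.Theorems.EntropyBudgetEquipartitionFreeEnergyRateUnitaryRateBounds

/-!
# Chatterjee's Theorem 2.1 for `U(N)` WITH A POWER RATE — part 2a: the error shapes

Helper for the crux `FreeEnergyRate` (stmt-QuantumFields-22402) of route `EntropyBudgetEquipartition`. Every error
term of the quantified Lemmas 17.4 / 17.7 (part 1, `…UnitaryRateBounds`) is bounded, for `β ≥ 1`, by a shape
`c·β^{−p}·(log β + 1)^j` with an explicit exponent `p > 0`, and the absorption lemma
`eventually_mul_rpow_neg_mul_log_pow_le` turns each shape into `≤ e·β^{−q}` eventually, for any `q < p`. Part 2b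
(`…UnitaryRate`) assembles the rate. Pure real analysis; no gauge theory; no definition introduced.
HONEST LABEL: bookkeeping for the `U(N)` helper; nothing here bears on the Clay mass gap.

References: S. Chatterjee, arXiv:1602.01222, §17.
-/

noncomputable section

namespace Summit.QuantumFields.YangMills.Theorems.FreeEnergyRate

open Filter Topology
open scoped NNReal
open Literature.MathematicalPhysics.QuantumLattice (unitaryFundamentalRep continuous_unitaryFundamentalRep
  freeEnergyDensity)
open Literature.MathematicalPhysics.QuantumFieldTheory
open Literature.MathematicalPhysics.QuantumFieldTheory.UnitaryCayley
open Literature.MathematicalPhysics.QuantumFieldTheory.WilsonWeakCoupling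
open Literature.MathematicalPhysics.QuantumFieldTheory.LatticeMaxwell
open Literature.MathematicalPhysics.QuantumFieldTheory.ChatterjeeAssembly
open Literature.MathematicalPhysics.QuantumFieldTheory.ChatterjeeFreeEnergy
open Literature.MathematicalPhysics.QuantumFieldTheory.ChatterjeeJointLimit

variable {d N : ℕ}

/-! ### §4. Absorbing `c β^{-p} (log β + 1)^j` into `β^{-q}` -/

/-- **Absorption**: for `q < p`, `e > 0` and any `c`, eventually `c β^{−p} (log β + 1)^j ≤ e β^{−q}`. [folklore] -/
theorem eventually_mul_rpow_neg_mul_log_pow_le (c : ℝ) {p q : ℝ} (hqp : q < p) (j : ℕ) {e : ℝ}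
    (he : 0 < e) : ∀ᶠ β : ℝ in atTop, c * β ^ (-p) * (Real.log β + 1) ^ j ≤ e * β ^ (-q) := by
  have ht : Tendsto (fun β : ℝ => β ^ (q - p) * Real.log β ^ j) atTop (𝓝 0) :=
    tendsto_rpow_mul_log_pow (by linarith) j
  have hK : 0 < |c| * 2 ^ j + 1 := by positivity
  filter_upwards [ht.eventually (ge_mem_nhds (show (0 : ℝ) < e / (|c| * 2 ^ j + 1) by positivity)),
    eventually_ge_atTop (Real.exp 1)] with β ht1 hβe
  have hβ0 : 0 < β := (Real.exp_pos 1).trans_le hβe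
  have hlog1 : 1 ≤ Real.log β := by
    rw [← Real.log_exp 1]; exact Real.log_le_log (Real.exp_pos 1) hβe
  have hp0 : 0 ≤ β ^ (-p) := Real.rpow_nonneg hβ0.le _
  have hq0 : 0 ≤ β ^ (-q) := Real.rpow_nonneg hβ0.le _
  have hl1 : 0 ≤ (Real.log β + 1) ^ j := pow_nonneg (by linarith) j
  have hpow : (Real.log β + 1) ^ j ≤ (2 * Real.log β) ^ j :=
    pow_le_pow_left₀ (by linarith) (by linarith) j
  have hsplit : β ^ (-p) = β ^ (-q) * β ^ (q - p) := by
    rw [← Real.rpow_add hβ0]; congr 1; ring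
  set t := β ^ (q - p) * Real.log β ^ j with htdef
  have ht0 : 0 ≤ t := mul_nonneg (Real.rpow_nonneg hβ0.le _) (pow_nonneg (by linarith) j)
  have h1 : c * β ^ (-p) * (Real.log β + 1) ^ j ≤ |c| * β ^ (-p) * (Real.log β + 1) ^ j :=
    mul_le_mul_of_nonneg_right (mul_le_mul_of_nonneg_right (le_abs_self c) hp0) hl1
  have h2 : |c| * β ^ (-p) * (Real.log β + 1) ^ j ≤ |c| * β ^ (-p) * (2 * Real.log β) ^ j :=
    mul_le_mul_of_nonneg_left hpow (by positivity)
  have h3 : |c| * β ^ (-p) * (2 * Real.log β) ^ j = (|c| * 2 ^ j) * t * β ^ (-q) := by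
    rw [hsplit, mul_pow, htdef]; ring
  have h4 : (|c| * 2 ^ j) * t ≤ e := by
    calc (|c| * 2 ^ j) * t ≤ (|c| * 2 ^ j) * (e / (|c| * 2 ^ j + 1)) :=
          mul_le_mul_of_nonneg_left ht1 (by positivity)
      _ ≤ (|c| * 2 ^ j + 1) * (e / (|c| * 2 ^ j + 1)) :=
          mul_le_mul_of_nonneg_right (by linarith) (by positivity)
      _ = e := by field_simp
  calc c * β ^ (-p) * (Real.log β + 1) ^ j ≤ (|c| * 2 ^ j) * t * β ^ (-q) := by
        rw [← h3]; exact h1.trans h2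
    _ ≤ e * β ^ (-q) := mul_le_mul_of_nonneg_right h4 hq0

/-! ### §4b. The shapes `c β^{-p} (log β + 1)^j` of the nine error terms (for `β ≥ 1`) -/

/-- `x / β^s = x · β^{-s} · (log β + 1)^0`. [folklore] -/
theorem div_rpow_eq_shape {β : ℝ} (hβ : 0 < β) (x s : ℝ) :
    x / β ^ s = x * β ^ (-s) * (Real.log β + 1) ^ 0 := by
  rw [pow_zero, mul_one, Real.rpow_neg hβ.le, div_eq_mul_inv]

/-- `√(β^s) = β^{s/2}`. [folklore] -/
theorem sqrt_rpow_eq {β : ℝ} (hβ : 0 < β) (s : ℝ) : Real.sqrt (β ^ s) = β ^ (s / 2) := by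
  rw [Real.sqrt_eq_rpow, ← Real.rpow_mul hβ.le]; congr 1; ring

/-- U4: `K₂ (2 log β/β^s) ≤ 2K₂ β^{-s} (log β + 1)`. [folklore] -/
theorem K₂_term_le {β : ℝ} (hβ : 1 ≤ β) (s : ℝ) :
    K₂ d N * (2 * Real.log β / β ^ s) ≤ 2 * K₂ d N * β ^ (-s) * (Real.log β + 1) ^ 1 := by
  have hβ0 : 0 < β := by linarith
  have hK := K₂_nonneg (d := d) (N := N)
  have hL0 : 0 ≤ Real.log β := Real.log_nonneg hβ
  rw [pow_one, Real.rpow_neg hβ0.le, div_eq_mul_inv]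
  have : 0 ≤ (β ^ s)⁻¹ := inv_nonneg.2 (Real.rpow_nonneg hβ0.le _)
  nlinarith [mul_nonneg hK this, mul_nonneg (mul_nonneg hK this) hL0]

/-- U3: `V(β) ≤ 2d(C + log 2) β^{-1/6} (log β + 1)` for `β ≥ 1`, `C ≥ 0`. [folklore] -/
theorem Vf_le_shape {C β : ℝ} (hC : 0 ≤ C) (hβ : 1 ≤ β) :
    Vf d C β ≤ 2 * d * (C + Real.log 2) * β ^ (-(1 / 6 : ℝ)) * (Real.log β + 1) := by
  have hβ0 : 0 < β := by linarith
  have hL0 : 0 ≤ Real.log β := Real.log_nonneg hβ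
  have hl2 : 0 ≤ Real.log 2 := Real.log_nonneg one_le_two
  have hd0 : (0 : ℝ) ≤ d := Nat.cast_nonneg d
  have hs0 : 0 ≤ β ^ (-(1 / 6 : ℝ)) := Real.rpow_nonneg hβ0.le _
  have hexp : β ^ (aU d - 1 / 3) ≤ β ^ (-(1 / 6 : ℝ)) :=
    Real.rpow_le_rpow_of_exponent_le hβ (by have := aU_le (d := d); linarith)
  unfold Vf
  have h1 : 2 * d * Real.log 2 * β ^ (aU d - 1 / 3) ≤ 2 * d * Real.log 2 * β ^ (-(1 / 6 : ℝ)) :=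
    mul_le_mul_of_nonneg_left hexp (by positivity)
  have h2 : C * Real.log β + Real.log 2 ≤ (C + Real.log 2) * (Real.log β + 1) := by
    nlinarith [mul_nonneg hl2 hL0]
  have h3 : 2 * d * β ^ (-(1 / 6 : ℝ)) * (C * Real.log β + Real.log 2) ≤
      2 * d * β ^ (-(1 / 6 : ℝ)) * ((C + Real.log 2) * (Real.log β + 1)) :=
    mul_le_mul_of_nonneg_left h2 (by positivity)
  calc 2 * d * C * (β ^ (-(1 / 6 : ℝ)) * Real.log β) + 2 * d * Real.log 2 * β ^ (aU d - 1 / 3)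
      ≤ 2 * d * C * (β ^ (-(1 / 6 : ℝ)) * Real.log β) + 2 * d * Real.log 2 * β ^ (-(1 / 6 : ℝ)) := by
        linarith
    _ = 2 * d * β ^ (-(1 / 6 : ℝ)) * (C * Real.log β + Real.log 2) := by ring
    _ ≤ 2 * d * β ^ (-(1 / 6 : ℝ)) * ((C + Real.log 2) * (Real.log β + 1)) := h3
    _ = 2 * d * (C + Real.log 2) * β ^ (-(1 / 6 : ℝ)) * (Real.log β + 1) := by ring

/-- U3 squared: `67²·64·N²d⁴·max(V,0)³ ≤ (67²·64·N²d⁴·c_V³) β^{-1/2} (log β + 1)³` for `β ≥ 1`. [folklore] -/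
theorem errU_sq_le_shape {β : ℝ} (hβ : 1 ≤ β) :
    67 ^ 2 * 64 * (N : ℝ) ^ 2 * (d : ℝ) ^ 4 * (max (Vf d (C71 d N) β) 0) ^ 3 ≤
      (67 ^ 2 * 64 * (N : ℝ) ^ 2 * (d : ℝ) ^ 4 * (2 * d * (C71 d N + Real.log 2)) ^ 3) *
        β ^ (-(1 / 2 : ℝ)) * (Real.log β + 1) ^ 3 := by
  have hβ0 : 0 < β := by linarith
  have hC0 : 0 ≤ C71 d N := (C71_spec d N).1.le
  have hL0 : 0 ≤ Real.log β := Real.log_nonneg hβ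
  have hV0 : 0 ≤ Vf d (C71 d N) β := by
    unfold Vf
    have : 0 ≤ β ^ (-(1 / 6 : ℝ)) := Real.rpow_nonneg hβ0.le _
    have : 0 ≤ β ^ (aU d - 1 / 3) := Real.rpow_nonneg hβ0.le _
    have : 0 ≤ Real.log 2 := Real.log_nonneg one_le_two
    positivity
  rw [max_eq_left hV0]
  have hV := Vf_le_shape (d := d) hC0 hβ
  have hcube : Vf d (C71 d N) β ^ 3 ≤ (2 * d * (C71 d N + Real.log 2) * β ^ (-(1 / 6 : ℝ)) * (Real.log β + 1)) ^ 3 :=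
    pow_le_pow_left₀ hV0 hV 3
  have hs : (β ^ (-(1 / 6 : ℝ))) ^ 3 = β ^ (-(1 / 2 : ℝ)) := by
    rw [← Real.rpow_mul_natCast hβ0.le]; norm_num
  calc 67 ^ 2 * 64 * (N : ℝ) ^ 2 * (d : ℝ) ^ 4 * Vf d (C71 d N) β ^ 3
      ≤ 67 ^ 2 * 64 * (N : ℝ) ^ 2 * (d : ℝ) ^ 4 *
          (2 * d * (C71 d N + Real.log 2) * β ^ (-(1 / 6 : ℝ)) * (Real.log β + 1)) ^ 3 :=
        mul_le_mul_of_nonneg_left hcube (by positivity)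
    _ = (67 ^ 2 * 64 * (N : ℝ) ^ 2 * (d : ℝ) ^ 4 * (2 * d * (C71 d N + Real.log 2)) ^ 3) *
        β ^ (-(1 / 2 : ℝ)) * (Real.log β + 1) ^ 3 := by rw [← hs]; ring

/-- L2: `e₀(β) ≤ (3dN² + 67d²N) β^{-1/5} (log β + 1)^0` for `β ≥ 1`. [folklore] -/
theorem e0_le_shape {β : ℝ} (hβ : 1 ≤ β) :
    e0 d N β ≤ (3 * d * (N : ℝ) ^ 2 + 67 * (d : ℝ) ^ 2 * N) * β ^ (-(1 / 5 : ℝ)) * (Real.log β + 1) ^ 0 := by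
  have hβ0 : 0 < β := by linarith
  have h : β ^ (-(2 / 5 : ℝ)) ≤ β ^ (-(1 / 5 : ℝ)) := Real.rpow_le_rpow_of_exponent_le hβ (by norm_num)
  have h0 : 0 ≤ β ^ (-(1 / 5 : ℝ)) := Real.rpow_nonneg hβ0.le _
  unfold e0
  rw [pow_zero, mul_one]
  have hd : (0 : ℝ) ≤ d := Nat.cast_nonneg d
  have hN : (0 : ℝ) ≤ N := Nat.cast_nonneg N
  nlinarith [mul_le_mul_of_nonneg_left h (by positivity : (0 : ℝ) ≤ 3 * d * (N : ℝ) ^ 2)]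

/-- L3: `err_LB(β) ≤ N²(2 log 2 + 8d² c_B) β^{-b} (log β + 1)`, `c_B = (2d+1)(log 3 + 3) + (log d + 8d² + 2)`,
for `β ≥ 1`, `d ≥ 1`. [folklore] -/
theorem errLB_le_shape (hd : 1 ≤ d) {β : ℝ} (hβ : 1 ≤ β) :
    errLB d N β ≤ (N : ℝ) ^ 2 * (2 * Real.log 2 + 8 * (d : ℝ) ^ 2 *
        ((2 * d + 1) * (Real.log 3 + 3) + (Real.log d + 8 * (d : ℝ) ^ 2 + 2))) *
      β ^ (-(bL d)) * (Real.log β + 1) ^ 1 := by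
  have hβ0 : 0 < β := by linarith
  have hL0 : 0 ≤ Real.log β := Real.log_nonneg hβ
  have hl2 : 0 ≤ Real.log 2 := Real.log_nonneg one_le_two
  have hl3 : 0 ≤ Real.log 3 := Real.log_nonneg (by norm_num)
  have hld : 0 ≤ Real.log d := Real.log_nonneg (by exact_mod_cast hd)
  have hd0 : (0 : ℝ) ≤ d := Nat.cast_nonneg d
  have hs0 : 0 ≤ β ^ (-(bL d)) := Real.rpow_nonneg hβ0.le _
  set R : ℝ := Real.log d + 8 * (d : ℝ) ^ 2 + 2 with hR
  have hR0 : 0 ≤ R := by positivity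
  have hB : Bbar d β ≤ ((2 * d + 1) * (Real.log 3 + 3) + R) * (Real.log β + 1) := by
    unfold Bbar
    rw [← hR]
    nlinarith [mul_nonneg hl3 hL0, mul_nonneg hR0 hL0, mul_nonneg hd0 (mul_nonneg hl3 hL0),
      mul_nonneg hd0 hL0]
  have hinv : (β ^ bL d)⁻¹ = β ^ (-(bL d)) := (Real.rpow_neg hβ0.le _).symm
  unfold errLB
  rw [pow_one, div_eq_mul_inv, div_eq_mul_inv, hinv]
  have hN2 : (0 : ℝ) ≤ (N : ℝ) ^ 2 := by positivity
  have e1 : 2 * Real.log 2 * β ^ (-(bL d)) ≤ 2 * Real.log 2 * β ^ (-(bL d)) * (Real.log β + 1) := by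
    have : 0 ≤ 2 * Real.log 2 * β ^ (-(bL d)) := by positivity
    nlinarith
  have e2 : 8 * (d : ℝ) ^ 2 * Bbar d β * β ^ (-(bL d)) ≤
      8 * (d : ℝ) ^ 2 * (((2 * d + 1) * (Real.log 3 + 3) + R) * (Real.log β + 1)) * β ^ (-(bL d)) :=
    mul_le_mul_of_nonneg_right (mul_le_mul_of_nonneg_left hB (by positivity)) hs0
  calc (N : ℝ) ^ 2 * (2 * Real.log 2 * β ^ (-(bL d)) + 8 * (d : ℝ) ^ 2 * Bbar d β * β ^ (-(bL d)))
      ≤ (N : ℝ) ^ 2 * (2 * Real.log 2 * β ^ (-(bL d)) * (Real.log β + 1) +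
          8 * (d : ℝ) ^ 2 * (((2 * d + 1) * (Real.log 3 + 3) + R) * (Real.log β + 1)) * β ^ (-(bL d))) :=
        mul_le_mul_of_nonneg_left (add_le_add e1 e2) hN2
    _ = _ := by ring

/-- L4: `K₃ (β^b/β^c) log β ≤ K₃ β^{-(c-b)} (log β + 1)`. [folklore] -/
theorem K₃_term_le {β : ℝ} (hβ : 1 ≤ β) :
    K₃ d N * (β ^ bL d / β ^ cL d * Real.log β) ≤ K₃ d N * β ^ (-(cL d - bL d)) * (Real.log β + 1) ^ 1 := by
  have hβ0 : 0 < β := by linarith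
  have hK := K₃_nonneg (d := d) (N := N)
  have hL0 : 0 ≤ Real.log β := Real.log_nonneg hβ
  have hq : β ^ bL d / β ^ cL d = β ^ (-(cL d - bL d)) := by
    rw [← Real.rpow_sub hβ0]; congr 1; ring
  rw [hq, pow_one]
  have : 0 ≤ K₃ d N * β ^ (-(cL d - bL d)) := mul_nonneg hK (Real.rpow_nonneg hβ0.le _)
  nlinarith

/-- L5: `J_D(β) ≤ c_J β^{-(1-b)} (log β + 1)` for `β ≥ 1`, with
`c_J = (d + 3d2^{d-1})(K_c + dN²/2) + (d+1)N² + 2^{d+1}(d+2)Nd²`. [folklore] -/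
theorem JD_le_shape {β : ℝ} (hβ : 1 ≤ β) :
    JD d N β ≤ (((d : ℝ) + 3 * d * 2 ^ (d - 1)) * (Kc d N + d * (N : ℝ) ^ 2 / 2) + ((d : ℝ) + 1) * (N : ℝ) ^ 2 +
        2 ^ (d + 1) * ((d : ℝ) + 2) * N * (d : ℝ) ^ 2) * β ^ (-(1 - bL d)) * (Real.log β + 1) ^ 1 := by
  have hβ0 : 0 < β := by linarith
  have hL0 : 0 ≤ Real.log β := Real.log_nonneg hβ
  have hK := Kc_nonneg (d := d) (N := N)
  have hd0 : (0 : ℝ) ≤ d := Nat.cast_nonneg d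
  have hN0 : (0 : ℝ) ≤ N := Nat.cast_nonneg N
  set s : ℝ := β ^ (-(1 - bL d)) with hsdef
  have hs0 : 0 ≤ s := Real.rpow_nonneg hβ0.le _
  have hb0 := (bL_pos (d := d)).le
  -- the three comparisons with `s`
  have c1 : 1 / β ^ 2 ≤ s := by
    rw [hsdef, one_div, ← Real.rpow_two, ← Real.rpow_neg hβ0.le]
    exact Real.rpow_le_rpow_of_exponent_le hβ (by linarith)
  have c2 : β ^ bL d / β = s := by
    rw [hsdef, ← Real.rpow_sub_one hβ0.ne']; congr 1; ring
  have c3 : 1 / β ≤ s := by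
    rw [hsdef, one_div, ← Real.rpow_neg_one]
    exact Real.rpow_le_rpow_of_exponent_le hβ (by linarith)
  unfold JD
  rw [pow_one, c2]
  set P : ℝ := Kc d N + d * (N : ℝ) ^ 2 / 2 with hP
  have hP0 : 0 ≤ P := by positivity
  -- summand 1
  have s1 : ((d : ℝ) / β ^ 2 + 3 * d * 2 ^ (d - 1) * s) * P * Real.log β ≤
      ((d : ℝ) + 3 * d * 2 ^ (d - 1)) * s * P * (Real.log β + 1) := by
    have h1 : (d : ℝ) / β ^ 2 ≤ d * s := by
      rw [div_eq_mul_one_div]; exact mul_le_mul_of_nonneg_left c1 hd0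
    have h2 : (d : ℝ) / β ^ 2 + 3 * d * 2 ^ (d - 1) * s ≤ ((d : ℝ) + 3 * d * 2 ^ (d - 1)) * s := by linarith
    have h3 : 0 ≤ ((d : ℝ) + 3 * d * 2 ^ (d - 1)) * s := by positivity
    calc ((d : ℝ) / β ^ 2 + 3 * d * 2 ^ (d - 1) * s) * P * Real.log β
        ≤ ((d : ℝ) + 3 * d * 2 ^ (d - 1)) * s * P * Real.log β :=
          mul_le_mul_of_nonneg_right (mul_le_mul_of_nonneg_right h2 hP0) hL0
      _ ≤ ((d : ℝ) + 3 * d * 2 ^ (d - 1)) * s * P * (Real.log β + 1) := by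
          have : 0 ≤ ((d : ℝ) + 3 * d * 2 ^ (d - 1)) * s * P := by positivity
          nlinarith
  -- summand 2
  have s2 : ((d : ℝ) + 1) * (N : ℝ) ^ 2 * (Real.log β / β ^ 2) ≤ ((d : ℝ) + 1) * (N : ℝ) ^ 2 * s * (Real.log β + 1) := by
    have h1 : Real.log β / β ^ 2 ≤ s * (Real.log β + 1) := by
      rw [div_eq_mul_one_div]
      calc Real.log β * (1 / β ^ 2) ≤ Real.log β * s := mul_le_mul_of_nonneg_left c1 hL0
        _ ≤ (Real.log β + 1) * s := mul_le_mul_of_nonneg_right (by linarith) hs0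
        _ = s * (Real.log β + 1) := mul_comm _ _
    have := mul_le_mul_of_nonneg_left h1 (by positivity : (0 : ℝ) ≤ ((d : ℝ) + 1) * (N : ℝ) ^ 2)
    linarith
  -- summand 3
  have s3 : 2 ^ (d + 1) * ((d : ℝ) + 2) * N * (d : ℝ) ^ 2 / β ≤
      2 ^ (d + 1) * ((d : ℝ) + 2) * N * (d : ℝ) ^ 2 * s * (Real.log β + 1) := by
    have h0 : 0 ≤ 2 ^ (d + 1) * ((d : ℝ) + 2) * N * (d : ℝ) ^ 2 := by positivity
    rw [div_eq_mul_one_div]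
    calc 2 ^ (d + 1) * ((d : ℝ) + 2) * N * (d : ℝ) ^ 2 * (1 / β)
        ≤ 2 ^ (d + 1) * ((d : ℝ) + 2) * N * (d : ℝ) ^ 2 * s := mul_le_mul_of_nonneg_left c3 h0
      _ ≤ 2 ^ (d + 1) * ((d : ℝ) + 2) * N * (d : ℝ) ^ 2 * s * (Real.log β + 1) := by
          have : 0 ≤ 2 ^ (d + 1) * ((d : ℝ) + 2) * N * (d : ℝ) ^ 2 * s := by positivity
          nlinarith
  calc ((d : ℝ) / β ^ 2 + 3 * d * 2 ^ (d - 1) * s) * P * Real.log β +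
        ((d : ℝ) + 1) * (N : ℝ) ^ 2 * (Real.log β / β ^ 2) + 2 ^ (d + 1) * ((d : ℝ) + 2) * N * (d : ℝ) ^ 2 / β
      ≤ ((d : ℝ) + 3 * d * 2 ^ (d - 1)) * s * P * (Real.log β + 1) +
        ((d : ℝ) + 1) * (N : ℝ) ^ 2 * s * (Real.log β + 1) +
        2 ^ (d + 1) * ((d : ℝ) + 2) * N * (d : ℝ) ^ 2 * s * (Real.log β + 1) := add_le_add (add_le_add s1 s2) s3
    _ = _ := by ring

end Summit.QuantumFields.YangMills.Theorems.FreeEnergyRate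

end
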